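import Mathlib
import Summits.NavierStokesRegularity.FluidComputer.AbcClassIIComplexBasesReality
import Summits.NavierStokesRegularity.FluidComputer.AbcLatticeEigenAnalysis

/-!
# GROUP-B, CLASS II — (D7): a class-II classical eigenpair HAS `amc`-coordinates, so ISOLATION in
# coordinates means «no other class-II eigenvalue» (profile-cert-3 g8, cell `ns-blowup`, 2026-08-27)

HONEST FRAMING (D-0035/D-0074): not a claim about Navier–Stokes blow-up. WHAT THIS IS NOT: not NS evidence;
MODEL lane (NS linearised about the forced ABC flow `abcFlow 1 1 1`, class II); no certificate, number or
census word moves. The 3-B-nested row theorems (`…_of_complex_bases`, cert-3 g8) conclude ISOLATION in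
`amc`-COORDINATES: every `H²`-summable coordinate eigenvector with eigenvalue `z ≠ λ⋆` in the ball vanishes.
This file turns that into the operator statement the census wants ((D7) of the residue list):
* `coords_of_classII_certifier_eigen` — a rapidly decaying, transversal, CLASS-II Cartesian coefficient family
  `c ≠ 0` with `c 0 = 0` solving the certifiers' eigen-equation `−(|k|²/R) c(k) + Π_k X(c)(k) = λ c(k)` has,
  in ANY complex orthonormal orbit-basis family `wf`, a non-zero `amc`-coordinate eigenvector with all polynomial
  moments finite (coordinates first in instab4's real basis `bfam` by complex completeness per orbit
  `AbcClassIIBasis.expand_complex`, the equation by pairing the certifiers' equation with the basis families —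
  locality `AbcClassIISynthesis.neighbour_value`, `amat_eq` —, Parseval per orbit, then the unitary transfer
  `ccoord_transfer_back` into the family `wf`);
* `eq_of_classII_eigenfunction_of_isolated` — **(D7)**: if `λ⋆` is isolated within `r` in `amc`-coordinates
  (conclusion ISOLATION of a row theorem) and `(z, u)` is ANY classical eigenpair of the linearisation about
  `abcFlow 1 1 1` at viscosity `1/(2πR)` (`Torus.LinNSResolventRel … (2πz) u 0`, `u ≠ 0`) whose Fourier
  coefficient family is class II, with `‖z − λ⋆‖ < r`, then `z = λ⋆` (`AbcLatticeEigenAnalysis` converse +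
  the above).
Mathlib + the files named; no new definitions. bears_on LADDER-NS N5 / Z4-a(1) ((D7) of every class-II
3-B-nested row of record). [folklore].
-/

noncomputable section

open scoped BigOperators ComplexConjugate InnerProductSpace
open Finset MeasureTheory UnitAddTorus

namespace Summit.NavierStokesRegularity.FluidComputer.AbcClassIIEigenpair

open Literature.Analysis.FunctionSpaces Literature.Analysis.FunctionSpaces.Torus
open Literature.Analysis.FunctionSpaces.EuclideanSpace
open Literature.Analysis.FluidPDE Literature.Analysis.FluidPDE.SteadyLattice
open Literature.Analysis.FluidPDE.ScalarFourier
open Summit.NavierStokesRegularity.FluidComputer.AbcClassII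

/-! ### §1 A rapidly decaying family has summable weighted squares -/

/-- `RapidDecay c ⇒ Σ_k (1 + |k|²)^s ‖c k‖² < ∞` for every `s`. -/
theorem summable_sq_weights_of_rapidDecay {c : Fam} (hc : RapidDecay c) (s : ℕ) :
    Summable fun k : Fin 3 → ℤ => (1 + freqNormSq k) ^ s * ‖c k‖ ^ 2 := by
  set C : ℝ := ∑' k, ‖c k‖ with hC
  have hle : ∀ k, ‖c k‖ ≤ C := fun k =>
    hc.summable_norm.le_tsum k fun j _ => norm_nonneg _
  refine Summable.of_nonneg_of_le (fun k => mul_nonneg (pow_nonneg (by linarith [freqNormSq_nonneg k]) _)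
    (sq_nonneg _)) (fun k => ?_) ((hc s).mul_right C)
  have h1 : 0 ≤ (1 + freqNormSq k) ^ s * ‖c k‖ :=
    mul_nonneg (pow_nonneg (by linarith [freqNormSq_nonneg k]) _) (norm_nonneg _)
  calc (1 + freqNormSq k) ^ s * ‖c k‖ ^ 2 = (1 + freqNormSq k) ^ s * ‖c k‖ * ‖c k‖ := by ring
    _ ≤ (1 + freqNormSq k) ^ s * ‖c k‖ * C := mul_le_mul_of_nonneg_left (hle k) h1

/-! ### §2 Coordinates of a class-II certifier eigenfamily in a complex orbit-basis family -/

section Coords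

variable (wf : Idx → Fam)
variable (hws : ∀ i : Idx, ∀ k ∉ i.1.1, wf i k = 0)
variable (hwt : ∀ (i : Idx) (k : Fin 3 → ℤ), ∑ j : Fin 3, ((k j : ℤ) : ℂ) * wf i k j = 0)
variable (hwII : ∀ i : Idx, IsClassII (wf i))
variable (hwon : ∀ (O : Orbit) (a b : Fin (odim O)),
  ∑ k ∈ O.1, (inner ℂ (wf ⟨O, a⟩ k) (wf ⟨O, b⟩ k) : ℂ) = if a = b then 1 else 0)
variable (amc : Idx → Idx → ℂ)
variable (hamc : ∀ i j : Idx, amc i j =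
  ∑ k ∈ i.1.1, (inner ℂ (wf i k) (Torus.lerayCoeff k (crossForm 1 1 1 (wf j) k)) : ℂ))

/-- **The `bfam`-coordinates of a class-II transversal family reproduce it on every orbit** (complex
completeness per orbit). -/
theorem expand_bfam_of_classII {c : Fam} (hct : ∀ k : Fin 3 → ℤ, ∑ j : Fin 3, ((k j : ℤ) : ℂ) * c k j = 0)
    (hcII : IsClassII c) (O : Orbit) :
    ∀ k ∈ O.1, c k = ∑ a : Fin (odim O), (∑ k' ∈ O.1, (inner ℂ (bfam ⟨O, a⟩ k') (c k') : ℂ)) • bfam ⟨O, a⟩ k := by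
  classical
  intro k hk
  set cO : Fam := fun k' => if k' ∈ O.1 then c k' else 0 with hcO
  have hsupp : ∀ k' ∉ O.1, cO k' = 0 := fun k' hk' => if_neg hk'
  have hexp := expand_complex O hsupp (kdot_cut hct O.1) (hcII.cut O.orbitClosed)
  have hcoef : ∀ a : Fin (odim O), ∑ k' ∈ O.1, (inner ℂ (bfam ⟨O, a⟩ k') (cO k') : ℂ) =
      ∑ k' ∈ O.1, (inner ℂ (bfam ⟨O, a⟩ k') (c k') : ℂ) := fun a =>
    Finset.sum_congr rfl fun k' hk' => by rw [hcO]; simp only [if_pos hk']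
  have hk' : c k = cO k := by rw [hcO]; simp only [if_pos hk]
  rw [hk']
  conv_lhs => rw [hexp]
  rw [Finset.sum_apply]
  exact Finset.sum_congr rfl fun a _ => by rw [hcoef a]; rfl

include hws hwt hwII hwon hamc in
/-- **A class-II certifier eigenfamily has a non-zero `amc`-coordinate eigenvector with all moments finite.** -/
theorem coords_of_classII_certifier_eigen {R : ℝ} (lam : ℂ) {c : Fam} (hcr : RapidDecay c)
    (hct : ∀ k : Fin 3 → ℤ, ∑ j : Fin 3, ((k j : ℤ) : ℂ) * c k j = 0) (hc0 : c 0 = 0) (hcII : IsClassII c)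
    (hL : ∀ k : Fin 3 → ℤ, ((-(freqNormSq k / R) : ℝ) : ℂ) • c k + Torus.lerayCoeff k (crossForm 1 1 1 c k) =
      lam • c k)
    (hcne : c ≠ 0) :
    ∃ x : Idx → ℂ, x ≠ 0 ∧
      (∀ i : Idx, ((-(onormSq i.1 / R) : ℝ) : ℂ) * x i + ∑ j ∈ nbrIdx i, amc i j * x j = lam * x i) ∧
      ∀ s : ℕ, Summable fun i : Idx => (1 + onormSq i.1) ^ s * ‖x i‖ ^ 2 := by
  classical
  -- coordinates in instab4's real basis
  set wa : Idx → ℂ := fun i => ∑ k' ∈ i.1.1, (inner ℂ (bfam i k') (c k') : ℂ) with hwa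
  have hexp : ∀ O : Orbit, ∀ k ∈ O.1, c k = ∑ a : Fin (odim O), wa ⟨O, a⟩ • bfam ⟨O, a⟩ k :=
    fun O k hk => expand_bfam_of_classII hct hcII O k hk
  -- the `amat`-equation
  have hcoordA : ∀ i : Idx, ((-(onormSq i.1 / R) : ℝ) : ℂ) * wa i +
      ∑ j ∈ nbrIdx i, ((amat i j : ℝ) : ℂ) * wa j = lam * wa i := by
    rintro ⟨O, a⟩
    -- the right-hand side and the diagonal part, paired with `bfam ⟨O, a⟩`
    have hrhs : lam * wa ⟨O, a⟩ = ∑ k ∈ O.1, (inner ℂ (bfam ⟨O, a⟩ k) (lam • c k) : ℂ) := by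
      change lam * ∑ k' ∈ O.1, (inner ℂ (bfam ⟨O, a⟩ k') (c k') : ℂ) = _
      rw [Finset.mul_sum]
      exact Finset.sum_congr rfl fun k _ => by rw [inner_smul_right]
    have hdiag : ∑ k ∈ O.1, (inner ℂ (bfam ⟨O, a⟩ k) (((-(freqNormSq k / R) : ℝ) : ℂ) • c k) : ℂ) =
        ((-(onormSq O / R) : ℝ) : ℂ) * wa ⟨O, a⟩ := by
      change _ = ((-(onormSq O / R) : ℝ) : ℂ) * ∑ k' ∈ O.1, (inner ℂ (bfam ⟨O, a⟩ k') (c k') : ℂ)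
      rw [Finset.mul_sum]
      exact Finset.sum_congr rfl fun k hk => by rw [inner_smul_right, O.freqNormSq_eq hk]
    -- the first-order part: locality, then the basis pairings
    set S : Finset Idx := (nbrOrbits O).sigma fun O' => (Finset.univ : Finset (Fin (odim O'))) with hS
    have hloc : ∀ k ∈ O.1, crossForm 1 1 1 c k = crossForm 1 1 1 (∑ j ∈ S, wa j • bfam j) k := by
      intro k hk
      rw [hS]
      unfold crossForm
      refine Finset.sum_congr rfl fun s hs => ?_
      rw [neighbour_value c wa hexp hc0 O hk hs]
      rfl
    have hfirst : ∑ k ∈ O.1, (inner ℂ (bfam ⟨O, a⟩ k) (Torus.lerayCoeff k (crossForm 1 1 1 c k)) : ℂ) =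
        ∑ j ∈ S, ((amat ⟨O, a⟩ j : ℝ) : ℂ) * wa j := by
      have e1 : ∀ k ∈ O.1, (inner ℂ (bfam ⟨O, a⟩ k) (Torus.lerayCoeff k (crossForm 1 1 1 c k)) : ℂ) =
          ∑ j ∈ S, wa j * (inner ℂ (bfam ⟨O, a⟩ k) (Torus.lerayCoeff k (crossForm 1 1 1 (bfam j) k)) : ℂ) := by
        intro k hk
        rw [hloc k hk, lerayCrossForm_sum_smul S (fun j => j) wa k, inner_sum]
        exact Finset.sum_congr rfl fun j _ => by rw [inner_smul_right]
      rw [Finset.sum_congr rfl e1, Finset.sum_comm]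
      refine Finset.sum_congr rfl fun j _ => ?_
      rw [← Finset.mul_sum, ← amat_eq ⟨O, a⟩ j, mul_comm]
    -- sum the certifiers' equation against `bfam ⟨O, a⟩`
    have hsum : ∑ k ∈ O.1, (inner ℂ (bfam ⟨O, a⟩ k)
        (((-(freqNormSq k / R) : ℝ) : ℂ) • c k + Torus.lerayCoeff k (crossForm 1 1 1 c k)) : ℂ) =
        ∑ k ∈ O.1, (inner ℂ (bfam ⟨O, a⟩ k) (lam • c k) : ℂ) :=
      Finset.sum_congr rfl fun k _ => by rw [hL k]
    simp only [inner_add_right, Finset.sum_add_distrib] at hsum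
    rw [hdiag, hfirst, ← hrhs] at hsum
    exact hsum
  -- Parseval per orbit and weighted summability
  have hpars : ∀ O : Orbit, ∑ a : Fin (odim O), ‖wa ⟨O, a⟩‖ ^ 2 = ∑ k ∈ O.1, ‖c k‖ ^ 2 := by
    intro O
    rw [← sum_norm_sq_orbitExpansion O wa]
    refine Finset.sum_congr rfl fun k hk => ?_
    rw [hexp O k hk, Finset.sum_apply]
    rfl
  have hsumA : ∀ s : ℕ, Summable fun i : Idx => (1 + onormSq i.1) ^ s * ‖wa i‖ ^ 2 := by
    intro s
    have htot := summable_sq_weights_of_rapidDecay hcr s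
    refine summable_of_sum_le (c := ∑' k, (1 + freqNormSq k) ^ s * ‖c k‖ ^ 2)
      (fun i => mul_nonneg (pow_nonneg (by linarith [onormSq_nonneg i.1]) _) (sq_nonneg _)) fun u => ?_
    obtain ⟨n, hn⟩ : ∃ n, u ⊆ cubeIdx n :=
      ⟨u.sup fun i => osupNorm i.1, fun i hi =>
        mem_cubeIdx.mpr (Finset.le_sup (f := fun i : Idx => osupNorm i.1) hi)⟩
    have hg0 : ∀ k, 0 ≤ (1 + freqNormSq k) ^ s * ‖c k‖ ^ 2 := fun k =>
      mul_nonneg (pow_nonneg (by linarith [freqNormSq_nonneg k]) _) (sq_nonneg _)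
    calc ∑ i ∈ u, (1 + onormSq i.1) ^ s * ‖wa i‖ ^ 2
        ≤ ∑ i ∈ cubeIdx n, (1 + onormSq i.1) ^ s * ‖wa i‖ ^ 2 :=
          Finset.sum_le_sum_of_subset_of_nonneg hn fun i _ _ =>
            mul_nonneg (pow_nonneg (by linarith [onormSq_nonneg i.1]) _) (sq_nonneg _)
      _ = ∑ O ∈ cubeOrbits n, ∑ k ∈ O.1, (1 + freqNormSq k) ^ s * ‖c k‖ ^ 2 := by
          rw [sum_cubeIdx_eq n (fun i => (1 + onormSq i.1) ^ s * ‖wa i‖ ^ 2)]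
          refine Finset.sum_congr rfl fun O _ => ?_
          change ∑ a : Fin (odim O), (1 + onormSq O) ^ s * ‖wa (⟨O, a⟩ : Idx)‖ ^ 2 = _
          rw [← Finset.mul_sum, hpars O, Finset.mul_sum]
          exact Finset.sum_congr rfl fun k hk => by rw [O.freqNormSq_eq hk]
      _ = ∑ k ∈ (cube n).filter (fun k => k ≠ 0), (1 + freqNormSq k) ^ s * ‖c k‖ ^ 2 :=
          (sum_cube_filter_eq n _).symm
      _ ≤ ∑' k, (1 + freqNormSq k) ^ s * ‖c k‖ ^ 2 := htot.sum_le_tsum _ fun k _ => hg0 k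
  -- non-vanishing
  have hwane : wa ≠ 0 := by
    intro h0
    apply hcne
    funext k
    by_cases hk : k = 0
    · subst hk; exact hc0
    · rw [hexp (toOrbit k hk) k (mem_sgnOrbit_self k)]
      rw [Pi.zero_apply]
      exact Finset.sum_eq_zero fun a _ => by rw [show wa ⟨toOrbit k hk, a⟩ = 0 from congrFun h0 _, zero_smul]
  -- into the complex family
  obtain ⟨x, -, hEx, hsumsx, hnex⟩ := ccoord_transfer_back wf hws hwt hwII hwon amc hamc lam wa hcoordA
  refine ⟨x, hnex hwane, hEx, fun s => ?_⟩
  exact summable_of_cube_sums (fun i => (1 + onormSq i.1) ^ s)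
    (fun i => pow_nonneg (by linarith [onormSq_nonneg i.1]) _) wa x
    (fun n => hsumsx n (fun O => (1 + onormSq O) ^ s)) (hsumA s)

include hws hwt hwII hwon hamc in
/-- **(D7) ISOLATION in coordinates ⇒ no other class-II eigenvalue.** If `λ⋆` is isolated within `r` in
`amc`-coordinates and `(z, u)` is a classical eigenpair of the linearisation about `abcFlow 1 1 1` at viscosity
`1/(2πR)` with `u ≠ 0`, class-II Fourier coefficients, and `‖z − λ⋆‖ < r`, then `z = λ⋆`. -/
theorem eq_of_classII_eigenfunction_of_isolated {R : ℝ} (hR : 1 ≤ R) (lam z : ℂ) {r : ℝ}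
    (hisol : ∀ z' : ℂ, z' ≠ lam → ‖z' - lam‖ < r →
      ∀ w : Idx → ℂ, (Summable fun i : Idx => (1 + onormSq i.1 / R) ^ 2 * ‖w i‖ ^ 2) →
        (∀ i : Idx, ((-(onormSq i.1 / R) : ℝ) : ℂ) * w i +
          ∑ j ∈ nbrIdx i, amc i j * w j = z' * w i) → w = 0)
    {u : UnitAddTorus (Fin 3) → EuclideanSpace ℂ (Fin 3)}
    (hu : Torus.LinNSResolventRel (1 / (2 * Real.pi * R)) (Torus.abcFlow 1 1 1) (2 * Real.pi * z) u 0)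
    (hu0 : u ≠ 0) (hII : IsClassII (mFourierCoeff u)) (hdist : ‖z - lam‖ < r) : z = lam := by
  have hR0 : 0 < R := by linarith
  obtain ⟨hcr, hct, hc0, hL, hne⟩ :=
    AbcLatticeEigenAnalysis.certifier_eigen_of_linNSResolventRel_abcFlow 1 1 1 hR0 z hu
  have hL' : ∀ k : Fin 3 → ℤ, ((-(freqNormSq k / R) : ℝ) : ℂ) • mFourierCoeff u k +
      Torus.lerayCoeff k (crossForm 1 1 1 (mFourierCoeff u) k) = z • mFourierCoeff u k := fun k => hL k
  obtain ⟨x, hx0, hEx, hsum⟩ :=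
    coords_of_classII_certifier_eigen wf hws hwt hwII hwon amc hamc z hcr hct hc0 hII hL' (hne hu0)
  by_contra hzl
  have hsum2 : Summable fun i : Idx => (1 + onormSq i.1 / R) ^ 2 * ‖x i‖ ^ 2 := by
    refine Summable.of_nonneg_of_le (fun i => mul_nonneg (sq_nonneg _) (sq_nonneg _)) (fun i => ?_) (hsum 2)
    have h3 : 1 + onormSq i.1 / R ≤ 1 + onormSq i.1 := by
      have h4 : onormSq i.1 / R ≤ onormSq i.1 := div_le_self (onormSq_nonneg i.1) hR
      linarith
    have h5 : 0 ≤ 1 + onormSq i.1 / R := by linarith [div_nonneg (onormSq_nonneg i.1) hR0.le]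
    exact mul_le_mul_of_nonneg_right (pow_le_pow_left₀ h5 h3 2) (sq_nonneg _)
  exact hx0 (hisol z hzl hdist x hsum2 hEx)

end Coords

end Summit.NavierStokesRegularity.FluidComputer.AbcClassIIEigenpair

end
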